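import Literature.Analysis.FluidPDE.NSHopfGalerkinLimit
import Literature.Analysis.FunctionSpaces.DuBoisReymond
import Literature.Analysis.FunctionSpaces.DuBoisReymondAE
import HarnessLib

/-!
# The time-sliced weak formulation of Leray–Hopf solutions on the flat torus

Analysis/FluidPDE support file (torus twin of `Literature.Analysis.FluidPDE.LerayHopfTimeSlice`,
now with a force). It serves the discharge of Marchioro's theorem
`Literature.Barriers.AnomalousDissipation.Marchioro1986_globalAttraction` (the first-shell ODE of
Foias–Manley–Rosa–Temam 2001, App. III.A.4, and the 2-D uniqueness fact
`Literature.Analysis.FluidPDE.lions_prodi_uniqueness_torus2` both start from it).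

The accepted `Torus.IsWeakNSSolutionForcedOn` (field `weak` of `Torus.IsLerayHopfOn`) is the
space–time (Leray) formulation: one identity for every smooth divergence-free space–time test
field on `T^d × [0, T)`. The **time-sliced** form says: for a fixed smooth divergence-free field
`Ψ` on `T^d` and every time `t ∈ (0, T]`,
`⟨u(t), Ψ⟩ = ⟨u₀, Ψ⟩ + ∫₀ᵗ ∫ (⟪u, (u·∇)Ψ⟫ + ν ⟪u, ΔΨ⟫ + ⟪f, Ψ⟫) ds`
(Temam 1984, Ch. III §1.1, (1.22) ⇔ (1.25) with Lemma III.1.1; Serrin 1963, §3, (6);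
Galdi 2000, Lemma 2.1; Robinson–Rodrigo–Sadowski 2016, (3.3)–(3.4)). We prove it for Leray–Hopf
solutions on `T^d` with a space–time square-integrable force:

* `IsSpaceTimeTest` / `IsDivFreeTest` for product fields `η(s) Ψ(x)` and the slice calculus
  `∂ₜ(ηΨ) = η'Ψ`, `(u·∇)(ηΨ) = η (u·∇)Ψ`, `Δ(ηΨ) = η ΔΨ`, `div (ηΨ) = η div Ψ`;
* `IsWeakNSSolutionForcedOn.test_smul`: testing the space–time formulation with `η(s)Ψ(x)`
  gives `∫_{(0,T)} (η' U + η F) + η(0) ⟨u₀,Ψ⟩ = 0` with `U(s) = ⟨u(s),Ψ⟩`,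
  `F(s) = ∫ (⟪u, (u·∇)Ψ⟫ + ν⟪u, ΔΨ⟫ + ⟪f, Ψ⟫)`;
* `IsLerayHopfOn.integral_inner_eq_add_setIntegral`: for a Leray–Hopf solution,
  `U(t) = ⟨u₀,Ψ⟩ + ∫_{(0,t]} F` for **every** `t ∈ (0, T]` (du Bois-Reymond lemma with initial
  datum, `Literature.Analysis.FunctionSpaces.eq_add_setIntegral_of_forall_test`, the continuous representative being supplied by
  the weak `L²`-continuity clause; the endpoint `t = T` by `t → T⁻`), and the incremental form
  `U(t) - U(s) = ∫_{(s,t]} F` (`IsLerayHopfOn.integral_inner_sub_eq_setIntegral`).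

## Mathlib search

Nothing on Navier–Stokes weak formulations in Mathlib; the tree has the whole-space unforced
time-sliced form (`Fluid.IsLerayHopfOn.inner_test_eq`, `LerayHopfTimeSlice`) and, on the torus,
the converse direction for Galerkin limits (`NS.IsHopfGalerkinScheme.weak_form_limit`), but not
this direction (searched `inner_test_eq`, `timeSlice`, `test_smul` in `Literature/Analysis/FluidPDE`).

## References

* R. Temam, *Navier–Stokes Equations*, 3rd ed., North-Holland 1984, Ch. III §1.1, (1.22)–(1.25),
  Lemma 1.1.
* J. Serrin, *The initial value problem for the Navier–Stokes equations*, in: Nonlinear Problems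
  (Madison 1962), Univ. Wisconsin Press 1963, §3.
* G. P. Galdi, *An introduction to the Navier–Stokes initial-boundary value problem*,
  Birkhäuser 2000, §2, Lemma 2.1.
* J. C. Robinson, J. L. Rodrigo, W. Sadowski, *The three-dimensional Navier–Stokes equations*
  (CUP 2016), Def. 3.3 and (3.3)–(3.4).
-/

noncomputable section

open MeasureTheory TopologicalSpace Set Function Filter Topology InnerProductSpace
open scoped RealInnerProductSpace ENNReal NNReal ContDiff

namespace Literature.Analysis.FluidPDE.Torus

variable {d : Type*} [Fintype d] [DecidableEq d]

/-! ### Product test fields `η(s) Ψ(x)` on the torus -/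

section TestField

variable {F : Type*} [NormedAddCommGroup F] [NormedSpace ℝ F]

omit [DecidableEq d] in
/-- The product `ψ(s,x) = η(s) Ψ(x)` of a smooth compactly supported `η` with `supp η ⊆ (-∞,T)`
and a smooth field `Ψ` on `T^d` is a space–time test field on `T^d × [0, T)`. [folklore] -/
theorem isSpaceTimeTest_smul {T : ℝ} {η : ℝ → ℝ} (hη : ContDiff ℝ ∞ η)
    (hηc : HasCompactSupport η) (hηT : tsupport η ⊆ Iio T) {Ψ : UnitAddTorus d → F}
    (hΨ : FunctionSpaces.Torus.IsSmooth Ψ) : FunctionSpaces.Torus.IsSpaceTimeTest T (fun s x => η s • Ψ x) := by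
  refine ⟨?_, ?_⟩
  · have h : FunctionSpaces.Torus.stLift (fun s x => η s • Ψ x) =
        fun p : ℝ × EuclideanSpace ℝ d => η p.1 • FunctionSpaces.Torus.lift Ψ p.2 := by
      funext p; rfl
    rw [h]
    exact (hη.comp contDiff_fst).smul ((hΨ : ContDiff ℝ ∞ (FunctionSpaces.Torus.lift Ψ)).comp contDiff_snd)
  · obtain ⟨T', hT'T, hT'⟩ := FunctionSpaces.exists_lt_forall_eq_zero_of_tsupport_subset_Iio hηc hηT
    exact ⟨T', hT'T, fun t ht => funext fun y => by simp [hT' t ht]⟩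

omit [Fintype d] in
/-- `∂ᵢ (η Ψ) = η ∂ᵢ Ψ` for a constant `η` (no differentiability needed: `deriv` of a constant
multiple over a field). [folklore] -/
theorem partialDeriv_const_smul_apply [Fintype d] (c : ℝ) (Ψ : UnitAddTorus d → F) (i : d)
    (x : UnitAddTorus d) : FunctionSpaces.Torus.partialDeriv i (fun y => c • Ψ y) x = c • FunctionSpaces.Torus.partialDeriv i Ψ x := by
  simp only [FunctionSpaces.Torus.partialDeriv, FunctionSpaces.Torus.lineDeriv]
  exact deriv_fun_const_smul_field c (fun t : ℝ => Ψ (x + FunctionSpaces.Torus.proj (t • EuclideanSpace.single i (1 : ℝ))))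

/-- The divergence of `η Ψ` is `η div Ψ`. [folklore] -/
theorem divergence_fun_const_smul (c : ℝ) (Ψ : UnitAddTorus d → EuclideanSpace ℝ d)
    (x : UnitAddTorus d) : FunctionSpaces.Torus.divergence (fun y => c • Ψ y) x = c * FunctionSpaces.Torus.divergence Ψ x := by
  simp only [FunctionSpaces.Torus.divergence, Finset.mul_sum]
  refine Finset.sum_congr rfl fun i _ => ?_
  have h : (fun y => (c • Ψ y) i) = fun y => c • (Ψ y i) := by
    funext y; simp [PiLp.smul_apply]
  rw [h, partialDeriv_const_smul_apply, smul_eq_mul]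

/-- Product test fields built on a divergence-free `Ψ` are divergence free at every time. [folklore] -/
theorem isDivFreeTest_smul (η : ℝ → ℝ) {Ψ : UnitAddTorus d → EuclideanSpace ℝ d}
    (hΨdiv : FunctionSpaces.Torus.IsDivFree Ψ) : FunctionSpaces.Torus.IsDivFreeTest (fun s x => η s • Ψ x) := fun s x => by
  change FunctionSpaces.Torus.divergence (fun y => η s • Ψ y) x = 0
  rw [divergence_fun_const_smul, hΨdiv x, mul_zero]

omit [Fintype d] [DecidableEq d] in
/-- Time derivative of a product field: `∂ₜ(η Ψ)(t,x) = η'(t) Ψ(x)`. [folklore] -/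
theorem timeDeriv_smul {η : ℝ → ℝ} (hη : Differentiable ℝ η) (Ψ : UnitAddTorus d → F) (t : ℝ)
    (x : UnitAddTorus d) : FunctionSpaces.Torus.timeDeriv (fun s y => η s • Ψ y) t x = deriv η t • Ψ x := by
  simp only [FunctionSpaces.Torus.timeDeriv]
  exact ((hη t).hasDerivAt.smul_const (Ψ x)).deriv

omit [DecidableEq d] in
/-- Convective derivative of a product field: `(u·∇)(η Ψ) = η (u·∇)Ψ` for `C¹` `Ψ`. [folklore] -/
theorem convect_const_smul (u : UnitAddTorus d → EuclideanSpace ℝ d) {Ψ : UnitAddTorus d → F}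
    (hΨ : FunctionSpaces.Torus.IsContDiff 1 Ψ) (c : ℝ) (x : UnitAddTorus d) :
    FunctionSpaces.Torus.convect u (fun y => c • Ψ y) x = c • FunctionSpaces.Torus.convect u Ψ x := by
  simp only [FunctionSpaces.Torus.convect]
  rw [show (fun y => c • Ψ y) = c • Ψ from rfl, FunctionSpaces.Torus.fderiv_const_smul hΨ c x]
  rfl

omit [DecidableEq d] in
/-- Laplacian of a product field: `Δ(η Ψ) = η ΔΨ` for smooth `Ψ`. [folklore] -/
theorem laplacian_const_smul {Ψ : UnitAddTorus d → F} (hΨ : FunctionSpaces.Torus.IsSmooth Ψ) (c : ℝ)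
    (x : UnitAddTorus d) : FunctionSpaces.Torus.laplacian (fun y => c • Ψ y) x = c • FunctionSpaces.Torus.laplacian Ψ x := by
  rw [FunctionSpaces.Torus.laplacian, FunctionSpaces.Torus.laplacian,
    show FunctionSpaces.Torus.liftAt (fun y => c • Ψ y) x = c • FunctionSpaces.Torus.liftAt Ψ x from rfl,
    InnerProductSpace.laplacian_smul c
      ((hΨ.isContDiff (n := 2) (WithTop.coe_le_coe.mpr le_top)).liftAt x).contDiffAt]

end TestField

/-! ### Bounds and integrability on a slice -/

section SliceBounds

/-- A smooth field on the compact torus has bounded partial derivatives: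
`∑ᵢ ‖∂ᵢΨ(x)‖ ≤ C`. [folklore] -/
theorem exists_sum_norm_partialDeriv_le {F : Type*} [NormedAddCommGroup F]
    [NormedSpace ℝ F] {Ψ : UnitAddTorus d → F} (hΨ : FunctionSpaces.Torus.IsSmooth Ψ) :
    ∃ C : ℝ, 0 ≤ C ∧ ∀ x, ∑ i, ‖FunctionSpaces.Torus.partialDeriv i Ψ x‖ ≤ C := by
  obtain ⟨C, hC⟩ := isCompact_univ.exists_bound_of_continuousOn
    (continuous_finsetSum Finset.univ fun i _ => (hΨ.partialDeriv i).continuous.norm).continuousOn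
  refine ⟨|C|, abs_nonneg C, fun x => ?_⟩
  have := hC x (mem_univ x)
  rw [Real.norm_eq_abs, abs_of_nonneg (Finset.sum_nonneg fun i _ => norm_nonneg _)] at this
  exact this.trans (le_abs_self C)

omit [Fintype d] [DecidableEq d] in
/-- A continuous field on the compact torus is bounded. [folklore] -/
theorem exists_nonneg_forall_norm_le_of_continuous {F : Type*} [NormedAddCommGroup F]
    {a : UnitAddTorus d → F} (ha : Continuous a) : ∃ K : ℝ, 0 ≤ K ∧ ∀ x, ‖a x‖ ≤ K := by
  obtain ⟨C, hC⟩ := (isCompact_univ.image ha).isBounded.exists_norm_le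
  exact ⟨|C|, abs_nonneg C, fun x => (hC _ ⟨x, mem_univ _, rfl⟩).trans (le_abs_self C)⟩

omit [DecidableEq d] in
/-- `|∫ ⟪U, a⟫| ≤ K ∫ ‖U‖` for an integrable field `U` and a field `a` bounded by `K`. [folklore] -/
theorem abs_integral_inner_le_of_norm_le {U a : UnitAddTorus d → EuclideanSpace ℝ d}
    (hU : Integrable U volume) {K : ℝ} (hK : ∀ x, ‖a x‖ ≤ K) :
    |∫ x, ⟪U x, a x⟫| ≤ K * ∫ x, ‖U x‖ := by
  rw [← integral_const_mul]
  refine abs_integral_le_integral_abs.trans (integral_mono_of_nonneg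
    (ae_of_all _ fun x => abs_nonneg _) (hU.norm.const_mul K) (ae_of_all _ fun x => ?_))
  calc |⟪U x, a x⟫| ≤ ‖U x‖ * ‖a x‖ := abs_real_inner_le_norm _ _
    _ ≤ ‖U x‖ * K := by gcongr; exact hK x
    _ = K * ‖U x‖ := mul_comm _ _

end SliceBounds

/-! ### The convective pairing `⟪U, (U·∇)Ψ⟫` of an `L²` field -/

section Convective

/-- Pointwise bound `|⟪U, (U·∇)Ψ⟫| ≤ C ‖U‖²` when `∑ᵢ ‖∂ᵢΨ‖ ≤ C`. [folklore] -/
theorem abs_inner_convect_self_le {U : UnitAddTorus d → EuclideanSpace ℝ d}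
    {Ψ : UnitAddTorus d → EuclideanSpace ℝ d} (hΨ : FunctionSpaces.Torus.IsContDiff 1 Ψ) {C : ℝ}
    (hC : ∀ x, ∑ i, ‖FunctionSpaces.Torus.partialDeriv i Ψ x‖ ≤ C) (x : UnitAddTorus d) :
    |⟪U x, FunctionSpaces.Torus.convect U Ψ x⟫| ≤ C * ‖U x‖ ^ 2 := by
  refine (abs_real_inner_le_norm _ _).trans ?_
  have h1 := FunctionSpaces.Torus.norm_convect_le U hΨ x
  calc ‖U x‖ * ‖FunctionSpaces.Torus.convect U Ψ x‖ ≤ ‖U x‖ * (‖U x‖ * C) := by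
        refine mul_le_mul_of_nonneg_left (h1.trans ?_) (norm_nonneg _)
        exact mul_le_mul_of_nonneg_left (hC x) (norm_nonneg _)
    _ = C * ‖U x‖ ^ 2 := by ring

/-- The convective pairing `x ↦ ⟪U, (U·∇)Ψ⟫` of an `L²` field against a smooth field is
integrable. [folklore] -/
theorem integrable_inner_convect_self {U : UnitAddTorus d → EuclideanSpace ℝ d}
    (hU : MemLp U 2 volume) {Ψ : UnitAddTorus d → EuclideanSpace ℝ d} (hΨ : FunctionSpaces.Torus.IsSmooth Ψ) :
    Integrable (fun x => ⟪U x, FunctionSpaces.Torus.convect U Ψ x⟫) volume := by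
  obtain ⟨C, -, hC⟩ := exists_sum_norm_partialDeriv_le hΨ
  refine Integrable.mono' ((hU.integrable_norm_pow two_ne_zero).const_mul C)
    (aestronglyMeasurable_inner_convect hU.1 hΨ) (ae_of_all _ fun x => ?_)
  rw [Real.norm_eq_abs]
  exact abs_inner_convect_self_le (hΨ.isContDiff (by simp)) hC x

/-- `|∫ ⟪U, (U·∇)Ψ⟫| ≤ C ∫ ‖U‖²` when `∑ᵢ ‖∂ᵢΨ‖ ≤ C`. [folklore] -/
theorem abs_integral_inner_convect_self_le {U : UnitAddTorus d → EuclideanSpace ℝ d}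
    (hU : MemLp U 2 volume) {Ψ : UnitAddTorus d → EuclideanSpace ℝ d} (hΨ : FunctionSpaces.Torus.IsSmooth Ψ) {C : ℝ}
    (hC : ∀ x, ∑ i, ‖FunctionSpaces.Torus.partialDeriv i Ψ x‖ ≤ C) :
    |∫ x, ⟪U x, FunctionSpaces.Torus.convect U Ψ x⟫| ≤ C * ∫ x, ‖U x‖ ^ 2 := by
  rw [← integral_const_mul]
  refine abs_integral_le_integral_abs.trans (integral_mono_of_nonneg
    (ae_of_all _ fun x => abs_nonneg _) ((hU.integrable_norm_pow two_ne_zero).const_mul C)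
    (ae_of_all _ fun x => ?_))
  exact abs_inner_convect_self_le (hΨ.isContDiff (by simp)) hC x

/-- The flux integrand `⟪U, (U·∇)Ψ⟫ + ν⟪U, ΔΨ⟫ + ⟪G, Ψ⟫` of an `L²` field `U` and an integrable
force slice `G` against a smooth `Ψ` is integrable. [folklore] -/
theorem integrable_nsFluxIntegrand {U G : UnitAddTorus d → EuclideanSpace ℝ d}
    (hU : MemLp U 2 volume) (hG : Integrable G volume) {Ψ : UnitAddTorus d → EuclideanSpace ℝ d}
    (hΨ : FunctionSpaces.Torus.IsSmooth Ψ) (ν : ℝ) :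
    Integrable (fun x => ⟪U x, FunctionSpaces.Torus.convect U Ψ x⟫ + ν * ⟪U x, FunctionSpaces.Torus.laplacian Ψ x⟫ + ⟪G x, Ψ x⟫) volume :=
  ((integrable_inner_convect_self hU hΨ).add ((FunctionSpaces.Torus.integrable_inner_of_continuous
    (hU.integrable one_le_two) hΨ.laplacian.continuous).const_mul ν)).add
    (FunctionSpaces.Torus.integrable_inner_of_continuous hG hΨ.continuous)

end Convective

/-! ### Testing the space–time formulation with a product field -/

section Slice

variable {T ν : ℝ} {f u : ℝ → UnitAddTorus d → EuclideanSpace ℝ d}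
  {u₀ : UnitAddTorus d → EuclideanSpace ℝ d}

/-- **The space–time weak formulation tested with a product field.** Let `u` be a forced weak
solution with datum on `T^d × [0, T)` (accepted `IsWeakNSSolutionForcedOn`) whose slices `u(s)`,
`s ∈ (0,T)`, are square integrable and whose force slices `f(s)` are integrable for a.e. `s`,
let `Ψ` be smooth and divergence free and `η ∈ C_c^∞(ℝ)` with `supp η ⊆ (-∞, T)`. Testing with
`ψ(s,x) = η(s)Ψ(x)` gives
`∫_{(0,T)} (η'(s) ⟨u(s),Ψ⟩ + η(s) ∫(⟪u,(u·∇)Ψ⟫ + ν⟪u,ΔΨ⟫ + ⟪f,Ψ⟫)) ds + η(0)⟨u₀,Ψ⟩ = 0`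
(Temam 1984, Ch. III (1.22)–(1.24); Galdi 2000, proof of Lemma 2.1). [folklore] -/
theorem IsWeakNSSolutionForcedOn.test_smul (hu : IsWeakNSSolutionForcedOn T ν f u₀ u)
    (hL2 : ∀ s ∈ Ioo 0 T, MemLp (u s) 2 volume)
    (hfL1 : ∀ᵐ s ∂(volume.restrict (Ioo 0 T)), Integrable (f s) volume)
    {Ψ : UnitAddTorus d → EuclideanSpace ℝ d} (hΨ : FunctionSpaces.Torus.IsSmooth Ψ) (hΨdiv : FunctionSpaces.Torus.IsDivFree Ψ)
    {η : ℝ → ℝ} (hη : ContDiff ℝ ∞ η) (hηc : HasCompactSupport η) (hηT : tsupport η ⊆ Iio T) :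
    (∫ s in Ioo 0 T, ((deriv η s * ∫ x, ⟪u s x, Ψ x⟫) +
        η s * ∫ x, (⟪u s x, FunctionSpaces.Torus.convect (u s) Ψ x⟫ + ν * ⟪u s x, FunctionSpaces.Torus.laplacian Ψ x⟫ + ⟪f s x, Ψ x⟫))) +
      η 0 * ∫ x, ⟪u₀ x, Ψ x⟫ = 0 := by
  obtain ⟨-, -, -, hweak⟩ := hu
  have hηd : Differentiable ℝ η := hη.differentiable (by simp)
  have key := hweak (fun s x => η s • Ψ x) (isSpaceTimeTest_smul hη hηc hηT hΨ)
    (isDivFreeTest_smul η hΨdiv)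
  have hinit : ∫ x, ⟪u₀ x, η 0 • Ψ x⟫ = η 0 * ∫ x, ⟪u₀ x, Ψ x⟫ := by
    simp only [real_inner_smul_right]
    exact integral_const_mul _ _
  have hslice : ∀ᵐ s ∂(volume.restrict (Ioo 0 T)),
      ∫ x, (⟪u s x, FunctionSpaces.Torus.timeDeriv (fun s x => η s • Ψ x) s x⟫ +
        ⟪u s x, FunctionSpaces.Torus.convect (u s) (fun x => η s • Ψ x) x⟫ +
        ν * ⟪u s x, FunctionSpaces.Torus.laplacian (fun x => η s • Ψ x) x⟫ + ⟪f s x, η s • Ψ x⟫) =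
      (deriv η s * ∫ x, ⟪u s x, Ψ x⟫) +
        η s * ∫ x, (⟪u s x, FunctionSpaces.Torus.convect (u s) Ψ x⟫ + ν * ⟪u s x, FunctionSpaces.Torus.laplacian Ψ x⟫ + ⟪f s x, Ψ x⟫) := by
    filter_upwards [hfL1, ae_restrict_mem measurableSet_Ioo] with s hfs hs
    have hus := hL2 s hs
    have i1 : Integrable (fun x => ⟪u s x, Ψ x⟫) volume :=
      FunctionSpaces.Torus.integrable_inner_of_continuous (hus.integrable one_le_two) hΨ.continuous
    have i2 := integrable_nsFluxIntegrand hus hfs hΨ ν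
    have hpt : (fun x => ⟪u s x, FunctionSpaces.Torus.timeDeriv (fun s x => η s • Ψ x) s x⟫ +
        ⟪u s x, FunctionSpaces.Torus.convect (u s) (fun x => η s • Ψ x) x⟫ +
        ν * ⟪u s x, FunctionSpaces.Torus.laplacian (fun x => η s • Ψ x) x⟫ + ⟪f s x, η s • Ψ x⟫) =
        fun x => deriv η s * ⟪u s x, Ψ x⟫ +
          η s * (⟪u s x, FunctionSpaces.Torus.convect (u s) Ψ x⟫ + ν * ⟪u s x, FunctionSpaces.Torus.laplacian Ψ x⟫ + ⟪f s x, Ψ x⟫) := by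
      ext x
      rw [timeDeriv_smul hηd, convect_const_smul (u s) (hΨ.isContDiff (by simp)) (η s),
        laplacian_const_smul hΨ]
      simp only [real_inner_smul_right]
      ring
    rw [hpt, integral_add (i1.const_mul _) (i2.const_mul _), integral_const_mul,
      integral_const_mul]
  rw [integral_congr_ae hslice, hinit] at key
  exact key

/-! ### Measurability and integrability in time of the slice functionals -/

/-- Joint measurability of a Leray–Hopf solution on `(0,T) × T^d` for the product measure. [folklore] -/
theorem IsLerayHopfOn.aestronglyMeasurable_uncurry (hu : IsLerayHopfOn T ν f u₀ u) :
    AEStronglyMeasurable (uncurry u) ((volume.restrict (Ioo 0 T)).prod volume) := by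
  have h := FunctionSpaces.Torus.aestronglyMeasurable_uncurry_of_stLift_restrict hu.weak.1
  rwa [Measure.volume_eq_prod, ← Measure.prod_restrict, Measure.restrict_univ] at h

/-- The pairing `s ↦ ⟨u(s), a⟩` of a Leray–Hopf solution with a continuous field is a.e.-strongly
measurable on `(0, T)` (Fubini). [folklore] -/
theorem IsLerayHopfOn.aestronglyMeasurable_integral_inner (hu : IsLerayHopfOn T ν f u₀ u)
    {a : UnitAddTorus d → EuclideanSpace ℝ d} (ha : Continuous a) :
    AEStronglyMeasurable (fun s => ∫ x, ⟪u s x, a x⟫) (volume.restrict (Ioo 0 T)) := by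
  have h1 : AEStronglyMeasurable (fun p : ℝ × UnitAddTorus d => ⟪uncurry u p, a p.2⟫)
      ((volume.restrict (Ioo 0 T)).prod volume) :=
    hu.aestronglyMeasurable_uncurry.inner (ha.comp continuous_snd).aestronglyMeasurable
  exact h1.integral_prod_right'

/-- The flux `s ↦ ∫ (⟪u, (u·∇)Ψ⟫ + ν⟪u, ΔΨ⟫ + ⟪f, Ψ⟫)` of a Leray–Hopf solution against a smooth
field is a.e.-strongly measurable on `(0, T)`. [folklore] -/
theorem IsLerayHopfOn.aestronglyMeasurable_flux (hu : IsLerayHopfOn T ν f u₀ u)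
    (hfm : AEStronglyMeasurable (FunctionSpaces.Torus.stLift f) (volume.restrict (Ioo 0 T ×ˢ univ)))
    {Ψ : UnitAddTorus d → EuclideanSpace ℝ d} (hΨ : FunctionSpaces.Torus.IsSmooth Ψ) :
    AEStronglyMeasurable
      (fun s => ∫ x, (⟪u s x, FunctionSpaces.Torus.convect (u s) Ψ x⟫ + ν * ⟪u s x, FunctionSpaces.Torus.laplacian Ψ x⟫ + ⟪f s x, Ψ x⟫))
      (volume.restrict (Ioo 0 T)) := by
  have hu' := hu.aestronglyMeasurable_uncurry
  have hf' : AEStronglyMeasurable (uncurry f) ((volume.restrict (Ioo 0 T)).prod volume) := by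
    have h := FunctionSpaces.Torus.aestronglyMeasurable_uncurry_of_stLift_restrict hfm
    rwa [Measure.volume_eq_prod, ← Measure.prod_restrict, Measure.restrict_univ] at h
  -- the convective term as a finite sum `∑ᵢ uᵢ ∂ᵢΨ`
  have hconv : (fun p : ℝ × UnitAddTorus d => FunctionSpaces.Torus.convect (u p.1) Ψ p.2) =
      fun p => ∑ i, (uncurry u p) i • FunctionSpaces.Torus.partialDeriv i Ψ p.2 := by
    funext p
    exact FunctionSpaces.Torus.fderiv_apply_eq_sum_partialDeriv (hΨ.isContDiff (by simp)) _ _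
  have hconvm : AEStronglyMeasurable (fun p : ℝ × UnitAddTorus d => FunctionSpaces.Torus.convect (u p.1) Ψ p.2)
      ((volume.restrict (Ioo 0 T)).prod volume) := by
    rw [hconv]
    exact Finset.aestronglyMeasurable_fun_sum _ fun i _ =>
      ((EuclideanSpace.proj (𝕜 := ℝ) i).continuous.comp_aestronglyMeasurable hu').smul
        ((hΨ.partialDeriv i).continuous.comp continuous_snd).aestronglyMeasurable
  have hL : AEStronglyMeasurable (fun p : ℝ × UnitAddTorus d => FunctionSpaces.Torus.laplacian Ψ p.2)
      ((volume.restrict (Ioo 0 T)).prod volume) :=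
    (hΨ.laplacian.continuous.comp continuous_snd).aestronglyMeasurable
  have hP : AEStronglyMeasurable (fun p : ℝ × UnitAddTorus d => Ψ p.2)
      ((volume.restrict (Ioo 0 T)).prod volume) :=
    (hΨ.continuous.comp continuous_snd).aestronglyMeasurable
  have h1 : AEStronglyMeasurable (fun p : ℝ × UnitAddTorus d =>
      ⟪uncurry u p, FunctionSpaces.Torus.convect (u p.1) Ψ p.2⟫ + ν * ⟪uncurry u p, FunctionSpaces.Torus.laplacian Ψ p.2⟫ +
        ⟪uncurry f p, Ψ p.2⟫) ((volume.restrict (Ioo 0 T)).prod volume) :=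
    ((hu'.inner hconvm).add ((hu'.inner hL).const_mul ν)).add (hf'.inner hP)
  exact h1.integral_prod_right'

/-- **A.e. energy bound in real form**: `∫ ‖u(s)‖² ≤ C` for a.e. `s ∈ (0,T)` with a real
constant (from the `L^∞(0,T;L²)` clause). [folklore] -/
theorem IsLerayHopfOn.exists_integral_norm_sq_le (hu : IsLerayHopfOn T ν f u₀ u) :
    ∃ C : ℝ, 0 ≤ C ∧ ∀ᵐ s ∂(volume.restrict (Ioo 0 T)), ∫ x, ‖u s x‖ ^ 2 ≤ C := by
  obtain ⟨C, hC⟩ := hu.energy_bound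
  refine ⟨(C : ℝ), C.2, ?_⟩
  filter_upwards [hC, ae_restrict_mem measurableSet_Ioo] with s hs hsI
  have hmem : MemLp (u s) 2 volume := hu.memLp s (Ioo_subset_Icc_self hsI)
  rw [Torus.lintegral_enorm_sq_eq_ofReal hmem] at hs
  have := ENNReal.toReal_mono ENNReal.coe_ne_top hs
  rwa [ENNReal.toReal_ofReal (integral_nonneg fun x => sq_nonneg _), ENNReal.coe_toReal] at this

omit [DecidableEq d] in
/-- `∫ ‖U‖ ≤ ½ (1 + ∫ ‖U‖²)` for `U ∈ L²(T^d)` (`‖U‖ ≤ ½(1 + ‖U‖²)` pointwise and the torus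
has volume one; a crude substitute for Cauchy–Schwarz that suffices for integrability). [folklore] -/
theorem integral_norm_le_of_memLp_two {U : UnitAddTorus d → EuclideanSpace ℝ d}
    (hU : MemLp U 2 volume) : ∫ x, ‖U x‖ ≤ 2⁻¹ * (1 + ∫ x, ‖U x‖ ^ 2) := by
  have i2 := hU.integrable_norm_pow two_ne_zero
  have h : ∫ x, ‖U x‖ ≤ ∫ x, 2⁻¹ * (1 + ‖U x‖ ^ 2) := by
    refine integral_mono_of_nonneg (ae_of_all _ fun x => norm_nonneg _)
      (((integrable_const (1 : ℝ)).add i2).const_mul _) (ae_of_all _ fun x => ?_)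
    nlinarith [sq_nonneg (‖U x‖ - 1)]
  refine h.trans_eq ?_
  rw [integral_const_mul, integral_add (integrable_const _) i2]
  simp

/-- The pairing `s ↦ ⟨u(s), a⟩` of a Leray–Hopf solution with a continuous field is integrable on
`(0, T)` (bounded a.e. by the energy). [folklore] -/
theorem IsLerayHopfOn.integrableOn_integral_inner (hu : IsLerayHopfOn T ν f u₀ u)
    {a : UnitAddTorus d → EuclideanSpace ℝ d} (ha : Continuous a) :
    IntegrableOn (fun s => ∫ x, ⟪u s x, a x⟫) (Ioo 0 T) := by
  obtain ⟨C, -, hC⟩ := hu.exists_integral_norm_sq_le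
  obtain ⟨K, hK0, hK⟩ := exists_nonneg_forall_norm_le_of_continuous ha
  refine ⟨hu.aestronglyMeasurable_integral_inner ha, ?_⟩
  refine HasFiniteIntegral.of_bounded (C := K * (2⁻¹ * (1 + C))) ?_
  filter_upwards [hC, ae_restrict_mem measurableSet_Ioo] with s hs hsI
  have hmem : MemLp (u s) 2 volume := hu.memLp s (Ioo_subset_Icc_self hsI)
  rw [Real.norm_eq_abs]
  refine (abs_integral_inner_le_of_norm_le (hmem.integrable one_le_two) hK).trans ?_
  refine mul_le_mul_of_nonneg_left ((integral_norm_le_of_memLp_two hmem).trans ?_) hK0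
  gcongr

/-- The flux `s ↦ ∫ (⟪u, (u·∇)Ψ⟫ + ν⟪u, ΔΨ⟫ + ⟪f, Ψ⟫)` of a Leray–Hopf solution with a
space–time square-integrable force against a smooth field is integrable on `(0, T)`:
the first two terms are bounded a.e. by the energy, the third by `‖Ψ‖_∞ ‖f(s)‖_{L¹}` with
`∫₀ᵀ ‖f(s)‖_{L¹} ds ≤ ∫₀ᵀ ½(1 + ‖f(s)‖₂²) ds < ∞`. [folklore] -/
theorem IsLerayHopfOn.integrableOn_flux (hu : IsLerayHopfOn T ν f u₀ u)
    (hfm : AEStronglyMeasurable (FunctionSpaces.Torus.stLift f) (volume.restrict (Ioo 0 T ×ˢ univ)))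
    (hf₂ : ∫⁻ t in Ioo 0 T, ∫⁻ x, ‖f t x‖ₑ ^ 2 < ⊤)
    {Ψ : UnitAddTorus d → EuclideanSpace ℝ d} (hΨ : FunctionSpaces.Torus.IsSmooth Ψ) :
    IntegrableOn
      (fun s => ∫ x, (⟪u s x, FunctionSpaces.Torus.convect (u s) Ψ x⟫ + ν * ⟪u s x, FunctionSpaces.Torus.laplacian Ψ x⟫ + ⟪f s x, Ψ x⟫))
      (Ioo 0 T) := by
  obtain ⟨C, hC0, hC⟩ := hu.exists_integral_norm_sq_le
  obtain ⟨D, hD0, hD⟩ := exists_sum_norm_partialDeriv_le hΨ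
  obtain ⟨KL, hKL0, hKL⟩ := exists_nonneg_forall_norm_le_of_continuous hΨ.laplacian.continuous
  obtain ⟨KP, hKP0, hKP⟩ := exists_nonneg_forall_norm_le_of_continuous hΨ.continuous
  -- the force: `f ∈ L²((0,T) × T^d)` for the product measure
  have hf' : AEStronglyMeasurable (uncurry f) ((volume.restrict (Ioo 0 T)).prod volume) := by
    have h := FunctionSpaces.Torus.aestronglyMeasurable_uncurry_of_stLift_restrict hfm
    rwa [Measure.volume_eq_prod, ← Measure.prod_restrict, Measure.restrict_univ] at h
  have hf2' : ∫⁻ p, ‖uncurry f p‖ₑ ^ 2 ∂((volume.restrict (Ioo 0 T)).prod volume) < ⊤ := by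
    rw [lintegral_prod _ (hf'.enorm.pow_const 2)]
    exact hf₂
  have hfL2 : MemLp (uncurry f) 2 ((volume.restrict (Ioo 0 T)).prod volume) :=
    ⟨hf', (eLpNorm_lt_top_iff_lintegral_rpow_enorm_lt_top two_ne_zero ENNReal.ofNat_ne_top).2
      (by simpa only [ENNReal.toReal_ofNat, ENNReal.rpow_two] using hf2')⟩
  -- hence `s ↦ ∫ ‖f s‖²` is integrable on `(0,T)` and `f s ∈ L²` for a.e. `s`
  have hfsq : Integrable (fun s => ∫ x, ‖f s x‖ ^ 2) (volume.restrict (Ioo 0 T)) := by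
    have h := (hfL2.integrable_norm_pow two_ne_zero).integral_prod_left
    exact h
  have hfs : ∀ᵐ s ∂(volume.restrict (Ioo 0 T)), MemLp (f s) 2 volume := by
    have hmeas : ∀ᵐ s ∂(volume.restrict (Ioo 0 T)), AEStronglyMeasurable (f s) volume :=
      hf'.prodMk_left
    have hint : AEMeasurable (fun s => ∫⁻ x, ‖f s x‖ₑ ^ 2) (volume.restrict (Ioo 0 T)) :=
      (hf'.aemeasurable.enorm.pow_const 2).lintegral_prod_right'
    have hfin : ∀ᵐ s ∂(volume.restrict (Ioo 0 T)), ∫⁻ x, ‖f s x‖ₑ ^ 2 < ⊤ :=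
      ae_lt_top' hint hf₂.ne
    filter_upwards [hmeas, hfin] with s hs hs'
    exact ⟨hs, (eLpNorm_lt_top_iff_lintegral_rpow_enorm_lt_top two_ne_zero
      ENNReal.ofNat_ne_top).2 (by simpa only [ENNReal.toReal_ofNat, ENNReal.rpow_two] using hs')⟩
  refine ⟨hu.aestronglyMeasurable_flux hfm hΨ, ?_⟩
  -- domination by an integrable function of `s`
  have hdom : ∀ᵐ s ∂(volume.restrict (Ioo 0 T)),
      ‖∫ x, (⟪u s x, FunctionSpaces.Torus.convect (u s) Ψ x⟫ + ν * ⟪u s x, FunctionSpaces.Torus.laplacian Ψ x⟫ + ⟪f s x, Ψ x⟫)‖ ≤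
        (D * C + |ν| * KL * (2⁻¹ * (1 + C))) + KP * (2⁻¹ * (1 + ∫ x, ‖f s x‖ ^ 2)) := by
    filter_upwards [hC, hfs, ae_restrict_mem measurableSet_Ioo] with s hs hfs2 hsI
    have hmem : MemLp (u s) 2 volume := hu.memLp s (Ioo_subset_Icc_self hsI)
    have i1 := integrable_inner_convect_self hmem hΨ
    have i2 : Integrable (fun x => ⟪u s x, FunctionSpaces.Torus.laplacian Ψ x⟫) volume :=
      FunctionSpaces.Torus.integrable_inner_of_continuous (hmem.integrable one_le_two) hΨ.laplacian.continuous
    have i3 : Integrable (fun x => ⟪f s x, Ψ x⟫) volume :=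
      FunctionSpaces.Torus.integrable_inner_of_continuous (hfs2.integrable one_le_two) hΨ.continuous
    have i12 : Integrable (fun x => ⟪u s x, FunctionSpaces.Torus.convect (u s) Ψ x⟫ + ν * ⟪u s x, FunctionSpaces.Torus.laplacian Ψ x⟫)
        volume := i1.add (i2.const_mul ν)
    rw [Real.norm_eq_abs, integral_add i12 i3, integral_add i1 (i2.const_mul ν),
      integral_const_mul]
    have b1 : |∫ x, ⟪u s x, FunctionSpaces.Torus.convect (u s) Ψ x⟫| ≤ D * C :=
      (abs_integral_inner_convect_self_le hmem hΨ hD).trans (by gcongr)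
    have b2 : |ν * ∫ x, ⟪u s x, FunctionSpaces.Torus.laplacian Ψ x⟫| ≤ |ν| * KL * (2⁻¹ * (1 + C)) := by
      rw [abs_mul, mul_assoc]
      refine mul_le_mul_of_nonneg_left ?_ (abs_nonneg ν)
      refine (abs_integral_inner_le_of_norm_le (hmem.integrable one_le_two) hKL).trans ?_
      refine mul_le_mul_of_nonneg_left ((integral_norm_le_of_memLp_two hmem).trans ?_) hKL0
      gcongr
    have b3 : |∫ x, ⟪f s x, Ψ x⟫| ≤ KP * (2⁻¹ * (1 + ∫ x, ‖f s x‖ ^ 2)) :=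
      (abs_integral_inner_le_of_norm_le (hfs2.integrable one_le_two) hKP).trans
        (mul_le_mul_of_nonneg_left (integral_norm_le_of_memLp_two hfs2) hKP0)
    calc _ ≤ |∫ x, ⟪u s x, FunctionSpaces.Torus.convect (u s) Ψ x⟫| + |ν * ∫ x, ⟪u s x, FunctionSpaces.Torus.laplacian Ψ x⟫| +
          |∫ x, ⟪f s x, Ψ x⟫| := abs_add_three _ _ _
      _ ≤ _ := by linarith
  refine HasFiniteIntegral.mono' (g := fun s =>
    (D * C + |ν| * KL * (2⁻¹ * (1 + C))) + KP * (2⁻¹ * (1 + ∫ x, ‖f s x‖ ^ 2))) ?_ hdom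
  have : IsFiniteMeasure (volume.restrict (Ioo (0 : ℝ) T)) := ⟨by
    rw [Measure.restrict_apply_univ]; exact measure_Ioo_lt_top⟩
  exact ((integrable_const _).add ((((integrable_const (1 : ℝ)).add hfsq).const_mul _).const_mul
    _)).hasFiniteIntegral

/-! ### The time-sliced identity -/

/-- **The time-sliced weak formulation of a Leray–Hopf solution on the torus.** Let `u` be a
Leray–Hopf weak solution on `T^d × [0, T)`, `T > 0`, with viscosity `ν`, datum `u₀` and a
space–time measurable force `f` with `∫₀ᵀ∫ ‖f‖² < ∞`, and let `Ψ` be a smooth divergence-free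
field on `T^d`. Then for **every** `t ∈ (0, T]`
`⟨u(t), Ψ⟩ = ⟨u₀, Ψ⟩ + ∫_{(0,t]} ∫ (⟪u, (u·∇)Ψ⟫ + ν ⟪u, ΔΨ⟫ + ⟪f, Ψ⟫) dx ds`
(Temam 1984, Ch. III §1.1, (1.22) ⇔ (1.25) and Lemma 1.1; Serrin 1963, §3, (6); Galdi 2000,
Lemma 2.1). Proof: `IsWeakNSSolutionForcedOn.test_smul` feeds the du Bois-Reymond lemma with
initial datum (`Literature.Analysis.FunctionSpaces.eq_add_setIntegral_of_forall_test`), the continuous representative being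
supplied by the weak `L²`-continuity clause of `IsLerayHopfOn` on `(0, T]`; the endpoint `t = T`
follows by letting `t → T⁻`. [cite: Temam1984, Ch. III §1.1 (1.22)–(1.25), Lemma 1.1] -/
theorem IsLerayHopfOn.integral_inner_eq_add_setIntegral (hu : IsLerayHopfOn T ν f u₀ u)
    (hT : 0 < T) (hfm : AEStronglyMeasurable (FunctionSpaces.Torus.stLift f) (volume.restrict (Ioo 0 T ×ˢ univ)))
    (hf₂ : ∫⁻ t in Ioo 0 T, ∫⁻ x, ‖f t x‖ₑ ^ 2 < ⊤)
    {Ψ : UnitAddTorus d → EuclideanSpace ℝ d} (hΨ : FunctionSpaces.Torus.IsSmooth Ψ) (hΨdiv : FunctionSpaces.Torus.IsDivFree Ψ)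
    {t : ℝ} (ht : t ∈ Ioc 0 T) :
    ∫ x, ⟪u t x, Ψ x⟫ = (∫ x, ⟪u₀ x, Ψ x⟫) + ∫ s in Ioc 0 t,
      ∫ x, (⟪u s x, FunctionSpaces.Torus.convect (u s) Ψ x⟫ + ν * ⟪u s x, FunctionSpaces.Torus.laplacian Ψ x⟫ + ⟪f s x, Ψ x⟫) := by
  have hUint := hu.integrableOn_integral_inner hΨ.continuous
  have hFint := hu.integrableOn_flux hfm hf₂ hΨ
  have hUcont : ContinuousOn (fun s => ∫ x, ⟪u s x, Ψ x⟫) (Ioc 0 T) :=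
    (hu.weak_continuous Ψ (hΨ.memLp 2)).1
  -- force slices are integrable for a.e. time
  have hf' : AEStronglyMeasurable (uncurry f) ((volume.restrict (Ioo 0 T)).prod volume) := by
    have h := FunctionSpaces.Torus.aestronglyMeasurable_uncurry_of_stLift_restrict hfm
    rwa [Measure.volume_eq_prod, ← Measure.prod_restrict, Measure.restrict_univ] at h
  have hfL1 : ∀ᵐ s ∂(volume.restrict (Ioo 0 T)), Integrable (f s) volume := by
    have hmeas : ∀ᵐ s ∂(volume.restrict (Ioo 0 T)), AEStronglyMeasurable (f s) volume :=
      hf'.prodMk_left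
    have hint : AEMeasurable (fun s => ∫⁻ x, ‖f s x‖ₑ ^ 2) (volume.restrict (Ioo 0 T)) :=
      (hf'.aemeasurable.enorm.pow_const 2).lintegral_prod_right'
    have hfin : ∀ᵐ s ∂(volume.restrict (Ioo 0 T)), ∫⁻ x, ‖f s x‖ₑ ^ 2 < ⊤ :=
      ae_lt_top' hint hf₂.ne
    filter_upwards [hmeas, hfin] with s hs hs'
    have hmem : MemLp (f s) 2 volume := ⟨hs, (eLpNorm_lt_top_iff_lintegral_rpow_enorm_lt_top
      two_ne_zero ENNReal.ofNat_ne_top).2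
        (by simpa only [ENNReal.toReal_ofNat, ENNReal.rpow_two] using hs')⟩
    exact hmem.integrable one_le_two
  have hid : ∀ η : ℝ → ℝ, ContDiff ℝ ∞ η → HasCompactSupport η → tsupport η ⊆ Iio T →
      (∫ s in Ioo 0 T, (deriv η s * (∫ x, ⟪u s x, Ψ x⟫) +
        η s * ∫ x, (⟪u s x, FunctionSpaces.Torus.convect (u s) Ψ x⟫ + ν * ⟪u s x, FunctionSpaces.Torus.laplacian Ψ x⟫ + ⟪f s x, Ψ x⟫))) +
        η 0 * (∫ x, ⟪u₀ x, Ψ x⟫) = 0 := fun η hη hηc hηT =>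
    hu.weak.test_smul (fun s hs => hu.memLp s (Ioo_subset_Icc_self hs)) hfL1 hΨ hΨdiv hη hηc hηT
  have hIoo : ∀ t ∈ Ioo 0 T, ∫ x, ⟪u t x, Ψ x⟫ = (∫ x, ⟪u₀ x, Ψ x⟫) + ∫ s in Ioc 0 t,
      ∫ x, (⟪u s x, FunctionSpaces.Torus.convect (u s) Ψ x⟫ + ν * ⟪u s x, FunctionSpaces.Torus.laplacian Ψ x⟫ + ⟪f s x, Ψ x⟫) :=
    fun t ht => FunctionSpaces.eq_add_setIntegral_of_forall_test hUint hFint (hUcont.mono Ioo_subset_Ioc_self)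
      hid ht
  rcases lt_or_eq_of_le ht.2 with htT | rfl
  · exact hIoo t ⟨ht.1, htT⟩
  · -- the endpoint: both sides are limits from the left within `(0, T)`
    haveI : (𝓝[Ioo 0 t] t).NeBot := by
      refine mem_closure_iff_nhdsWithin_neBot.1 ?_
      rw [closure_Ioo hT.ne]
      exact right_mem_Icc.2 hT.le
    set Fl : ℝ → ℝ := fun s =>
      ∫ x, (⟪u s x, FunctionSpaces.Torus.convect (u s) Ψ x⟫ + ν * ⟪u s x, FunctionSpaces.Torus.laplacian Ψ x⟫ + ⟪f s x, Ψ x⟫)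
    have h1 : Tendsto (fun s => ∫ x, ⟪u s x, Ψ x⟫) (𝓝[Ioo 0 t] t) (𝓝 (∫ x, ⟪u t x, Ψ x⟫)) :=
      (hUcont t ⟨hT, le_rfl⟩).mono Ioo_subset_Ioc_self
    have hFint' : IntegrableOn Fl (Icc 0 t) :=
      (integrableOn_Icc_iff_integrableOn_Ioo (by simp) (by simp)).2 hFint
    have h2 : Tendsto (fun τ => (∫ x, ⟪u₀ x, Ψ x⟫) + ∫ s in Ioc 0 τ, Fl s) (𝓝[Ioo 0 t] t)
        (𝓝 ((∫ x, ⟪u₀ x, Ψ x⟫) + ∫ s in Ioc 0 t, Fl s)) := by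
      have hprim : ContinuousWithinAt (fun τ => ∫ s in Ioc 0 τ, Fl s) (Ioo 0 t) t :=
        (intervalIntegral.continuousOn_primitive hFint' t (right_mem_Icc.2 hT.le)).mono
          Ioo_subset_Icc_self
      exact tendsto_const_nhds.add hprim
    have heq : (fun s => ∫ x, ⟪u s x, Ψ x⟫) =ᶠ[𝓝[Ioo 0 t] t]
        fun τ => (∫ x, ⟪u₀ x, Ψ x⟫) + ∫ s in Ioc 0 τ, Fl s :=
      eventually_mem_nhdsWithin.mono fun τ hτ => hIoo τ hτ
    exact tendsto_nhds_unique (h1.congr' heq) h2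

/-- **Incremental form of the time-sliced identity**: for `0 < s ≤ t ≤ T`,
`⟨u(t), Ψ⟩ - ⟨u(s), Ψ⟩ = ∫_{(s,t]} ∫ (⟪u, (u·∇)Ψ⟫ + ν ⟪u, ΔΨ⟫ + ⟪f, Ψ⟫)`
(Temam 1984, Ch. III (1.25) integrated; difference of two instances of
`integral_inner_eq_add_setIntegral`). [cite: Temam1984, Ch. III §1.1 (1.25)] -/
theorem IsLerayHopfOn.integral_inner_sub_eq_setIntegral (hu : IsLerayHopfOn T ν f u₀ u)
    (hT : 0 < T) (hfm : AEStronglyMeasurable (FunctionSpaces.Torus.stLift f) (volume.restrict (Ioo 0 T ×ˢ univ)))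
    (hf₂ : ∫⁻ t in Ioo 0 T, ∫⁻ x, ‖f t x‖ₑ ^ 2 < ⊤)
    {Ψ : UnitAddTorus d → EuclideanSpace ℝ d} (hΨ : FunctionSpaces.Torus.IsSmooth Ψ) (hΨdiv : FunctionSpaces.Torus.IsDivFree Ψ)
    {s t : ℝ} (hs : 0 < s) (hst : s ≤ t) (htT : t ≤ T) :
    (∫ x, ⟪u t x, Ψ x⟫) - ∫ x, ⟪u s x, Ψ x⟫ = ∫ τ in Ioc s t,
      ∫ x, (⟪u τ x, FunctionSpaces.Torus.convect (u τ) Ψ x⟫ + ν * ⟪u τ x, FunctionSpaces.Torus.laplacian Ψ x⟫ + ⟪f τ x, Ψ x⟫) := by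
  have hFint := hu.integrableOn_flux hfm hf₂ hΨ
  rw [hu.integral_inner_eq_add_setIntegral hT hfm hf₂ hΨ hΨdiv ⟨hs.trans_le hst, htT⟩,
    hu.integral_inner_eq_add_setIntegral hT hfm hf₂ hΨ hΨdiv ⟨hs, hst.trans htT⟩]
  have hsub : IntegrableOn (fun τ => ∫ x, (⟪u τ x, FunctionSpaces.Torus.convect (u τ) Ψ x⟫ +
      ν * ⟪u τ x, FunctionSpaces.Torus.laplacian Ψ x⟫ + ⟪f τ x, Ψ x⟫)) (Ioc 0 t) := by
    refine (hFint.mono_set ?_).congr_set_ae Ioo_ae_eq_Ioc.symm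
    exact Ioo_subset_Ioo le_rfl htT
  rw [← Ioc_union_Ioc_eq_Ioc hs.le hst, setIntegral_union (Ioc_disjoint_Ioc_of_le le_rfl)
    measurableSet_Ioc (hsub.mono_set (Ioc_subset_Ioc_right hst))
    (hsub.mono_set (Ioc_subset_Ioc_left hs.le))]
  ring

end Slice

end Literature.Analysis.FluidPDE.Torus
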